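import Summits.HubbardSuperconductivity.HubbardSuperconductivity.Theorems.AnisotropyChordTransferSpinSquared
import Summits.HubbardSuperconductivity.HubbardSuperconductivity.Theorems.AnisotropyChordTransferTranslation
import Summits.HubbardSuperconductivity.HubbardSuperconductivity.Theorems.AnisotropyChordTowerParticleHole
import Summits.HubbardSuperconductivity.HubbardSuperconductivity.Theorems.AnisotropyChordTowerPerturbation

/-!
# Route `AnisotropyChord` / H0 rotor rung, route (1) «ODLRO transfer across sectors»: THE ONE-LINK TEMPLE STEP of
# THEOREM T (theory seat `hubbard-h0-rotor-theory-1`, cycle 12, memo ROTOR-THEORY-11 §175, THEOREM-T.md «Temple step» +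
# «Transfer»; prover seat `hubbard-h0-rotor-p1` g13)

For Perron sector ground amplitudes `a` (sector `M`, translation invariant, `S⁺a ≠ 0`) and `a'` (sector `M+1`), the symmetric
sector gap in TEMPLE FORM at the sector `M+1` (hypothesis (H2) of THEOREM T, instantiated) plus the landed TRANSFER inequality give
the per-link bound
`⟨S⃗²⟩_{a'} ≥ ⟨S⃗²⟩_a − (L/c₁)·(⟨S⁺a, H S⁺a⟩ − E(M+1)‖S⁺a‖²)` (`totalSpinSq_succ_ge_of_gap`):
the test state `φ = S⁺a/‖S⁺a‖` is unit, translation invariant and lies in the sector `M+1`; `⟨a', φ⟩² = towerFidelity a a'`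
and `⟨φ, Hφ⟩ = ⟨S⁺a, H S⁺a⟩/‖S⁺a‖²`.  Also the variational floor `E(M)·Σ b² ≤ ⟨b, H b⟩` for amplitudes supported on a sector
(`sectorE_mul_le_energyQ`, from the tree's `rayleigh_real`).  The remaining inputs of THEOREM T (LEMMA E `LadderExcessBound`, (H3))
bound the numerator by `O((1−Δ)|V|)`; they are separate items.
-/

set_option linter.dupNamespace false
set_option autoImplicit false

noncomputable section

open Finset Filter Topology
open Literature.MathematicalPhysics.QuantumLattice Literature.Probability.LatticeModels
open Summit.HubbardSuperconductivity.HubbardSuperconductivity.Theorems.AnisotropyChord.InsertionEntropy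
open Summit.HubbardSuperconductivity.HubbardSuperconductivity.Theorems.AnisotropyChord.Tower
open Summit.HubbardSuperconductivity.HubbardSuperconductivity.Theorems.AnisotropyChord

namespace Summit.HubbardSuperconductivity.HubbardSuperconductivity.Theorems.AnisotropyChord.Transfer

variable (L : ℕ) [NeZero L]

/-- the FM-side XXZ torus Hamiltonian `H(Δ)` of the route (VERBATIM port of the theory seat's `ham`, PartE.lean). [folklore] -/
def ham (Δ : ℝ) : Matrix (TensorIndex (TorusSite 2 L) 2) (TensorIndex (TorusSite 2 L) 2) ℂ :=
  xxzHamiltonian 1 (torusGraph 2 L) (-1) Δ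

/-- quadratic form `⟨φ, H(Δ) φ⟩` of a real amplitude (VERBATIM port of the theory seat's `energyQ`, PartE.lean). [folklore] -/
def energyQ (Δ : ℝ) (φ : TensorIndex (TorusSite 2 L) 2 → ℝ) : ℝ :=
  (star (cplx L φ) ⬝ᵥ (ham L Δ).mulVec (cplx L φ)).re

/-- sector ground energy `E(M)` (VERBATIM port of the theory seat's `sectorE`, PartE.lean). [folklore] -/
def sectorE (Δ M : ℝ) : ℝ := lowestEnergyInSector 1 (ham L Δ) M

variable {L}

/-! ## Real form, scaling and the variational floor of `energyQ` -/

/-- `⟨φ, Hφ⟩` in real amplitude form: `Σ φ(Aφ + (1−Δ)Wφ) − (D/8)Σφ²`. [folklore] -/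
theorem energyQ_eq_real (Δ : ℝ) (φ : TensorIndex (TorusSite 2 L) 2 → ℝ) :
    energyQ L Δ φ = (∑ σ, φ σ * (fmOp (torusGraph 2 L) φ σ + (1 - Δ) * (isingW (torusGraph 2 L) σ * φ σ)))
      - (1/8 : ℝ) * (∑ x : TorusSite 2 L, ∑ y, if (torusGraph 2 L).Adj x y then (1:ℝ) else 0) * ∑ σ, φ σ ^ 2 := by
  unfold energyQ ham cplx
  rw [star_dotProduct_xxz_real, Complex.ofReal_re]

/-- quadratic scaling `⟨cφ, H cφ⟩ = c²⟨φ, Hφ⟩`. [folklore] -/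
theorem energyQ_smul (Δ c : ℝ) (φ : TensorIndex (TorusSite 2 L) 2 → ℝ) :
    energyQ L Δ (c • φ) = c ^ 2 * energyQ L Δ φ := by
  unfold energyQ
  have h : cplx L (c • φ) = (c : ℂ) • cplx L φ := by
    funext σ; simp [cplx, Pi.smul_apply, smul_eq_mul]
  rw [h, Matrix.mulVec_smul, star_smul, smul_dotProduct, dotProduct_smul]
  simp only [Complex.star_def, Complex.conj_ofReal, smul_eq_mul]
  rw [Complex.re_ofReal_mul, Complex.re_ofReal_mul]
  ring

/-- **variational floor:** for a real amplitude supported on the sector `Sᶻ = M`, `E(M)·Σ b² ≤ ⟨b, Hb⟩`. [folklore] -/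
theorem sectorE_mul_le_energyQ (Δ M : ℝ) (b : TensorIndex (TorusSite 2 L) 2 → ℝ)
    (hb : ∀ σ, b σ ≠ 0 → zerosCard σ = (Fintype.card (TorusSite 2 L) : ℝ) / 2 + M) :
    sectorE L Δ M * ∑ σ, b σ ^ 2 ≤ energyQ L Δ b := by
  have h := rayleigh_real Δ M b hb
  rw [energyQ_eq_real]
  unfold sectorE ham
  nlinarith [h]

/-! ## The test state `S⁺a/‖S⁺a‖` -/

/-- `raiseSum` of an automorphism-invariant amplitude is automorphism invariant. [folklore] -/
theorem raiseSum_comp_equiv {V : Type} [Fintype V] [DecidableEq V] (φ : V ≃ V) (b : (V → Fin 2) → ℝ)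
    (hb : ∀ σ, b (σ ∘ φ) = b σ) (σ : V → Fin 2) : raiseSum b (σ ∘ φ) = raiseSum b σ := by
  unfold raiseSum
  have key : ∀ x, (if (σ ∘ φ) x = 0 then b (Function.update (σ ∘ φ) x 1) else 0)
      = (fun y => if σ y = 0 then b (Function.update σ y 1) else 0) (φ x) := by
    intro x
    have hupd : Function.update (σ ∘ φ) x 1 = Function.update σ (φ x) 1 ∘ φ := by
      rw [Function.update_comp_equiv σ φ (φ x) 1, Equiv.symm_apply_apply]
    simp only [Function.comp_apply, hupd, hb]
  rw [Finset.sum_congr rfl (fun x _ => key x)]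
  exact Equiv.sum_comp φ (fun y => if σ y = 0 then b (Function.update σ y 1) else 0)

/-- `S⁺a` of a translation-invariant amplitude is translation invariant. [folklore] -/
theorem raiseSum_shiftCfg (a : TensorIndex (TorusSite 2 L) 2 → ℝ) (ha : ∀ v σ, a (shiftCfg L v σ) = a σ)
    (v : TorusSite 2 L) (σ : TensorIndex (TorusSite 2 L) 2) : raiseSum a (shiftCfg L v σ) = raiseSum a σ := by
  rw [shiftCfg_eq_comp]
  apply raiseSum_comp_equiv (torusTranslationIso L v).toEquiv a
  intro τ
  have := ha v τ
  rw [shiftCfg_eq_comp] at this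
  exact this

/-- `S⁺a` of a Perron sector-`M` amplitude is supported on the sector `M + 1`. [folklore] -/
theorem raiseSum_support_perron {Δ M : ℝ} {a : TensorIndex (TorusSite 2 L) 2 → ℝ}
    (ha : IsPerronSectorGroundAmplitude L Δ M a) (σ : TensorIndex (TorusSite 2 L) 2) (hσ : raiseSum a σ ≠ 0) :
    zerosCard σ = (Fintype.card (TorusSite 2 L) : ℝ) / 2 + (M + 1) := by
  have h := raiseSum_support a ((Fintype.card (TorusSite 2 L) : ℝ) / 2 + M) (fun ν hν => perron_support ha ν hν) σ hσ
  rw [h]; ring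

/-- `⟨a', S⁺a⟩ = towerSum a a'`. [folklore] -/
theorem sum_mul_raiseSum_eq_towerSum (a a' : TensorIndex (TorusSite 2 L) 2 → ℝ) :
    ∑ σ, a' σ * raiseSum a σ = towerSum a a' := by
  rw [towerSum_eq_raise]
  exact Finset.sum_congr rfl fun σ _ => mul_comm _ _

/-! ## The one-link Temple step -/

/-- **ONE-LINK TEMPLE STEP of THEOREM T.**  `a` = Perron amplitude of sector `M` (translation invariant, `S⁺a ≠ 0`),
`a'` = Perron amplitude of sector `M + 1`; the symmetric sector gap at `M + 1` in Temple form (hypothesis (H2), instantiated at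
`a'`) gives `⟨S⃗²⟩_a − (L/c₁)·(⟨S⁺a, H S⁺a⟩ − E(M+1)‖S⁺a‖²) ≤ ⟨S⃗²⟩_{a'}`.
[conjecture: theory seat hubbard-h0-rotor-theory-1, cycle 12, memo §175 — Temple step + transfer of THEOREM T; Lean proof here] -/
theorem totalSpinSq_succ_ge_of_gap {Δ c₁ M : ℝ} (hc₁ : 0 < c₁) {a a' : TensorIndex (TorusSite 2 L) 2 → ℝ}
    (ha : IsPerronSectorGroundAmplitude L Δ M a) (ha' : IsPerronSectorGroundAmplitude L Δ (M + 1) a')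
    (hgap : ∀ φ : TensorIndex (TorusSite 2 L) 2 → ℝ,
      cplx L φ ∈ spinZSector (Λ := TorusSite 2 L) 1 (M + 1) → (∀ v σ, φ (shiftCfg L v σ) = φ σ) → ∑ σ, φ σ ^ 2 = 1 →
        c₁ / (L : ℝ) * (1 - (∑ σ, a' σ * φ σ) ^ 2) ≤ energyQ L Δ φ - sectorE L Δ (M + 1))
    (hinv : ∀ v σ, a (shiftCfg L v σ) = a σ) (hN : 0 < raiseNormSq a) :
    Summit.HubbardSuperconductivity.HubbardSuperconductivity.Theorems.AnisotropyChord.Tower.totalSpinSq a M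
      - (L : ℝ) / c₁ * (energyQ L Δ (raiseSum a) - sectorE L Δ (M + 1) * raiseNormSq a)
      ≤ Summit.HubbardSuperconductivity.HubbardSuperconductivity.Theorems.AnisotropyChord.Tower.totalSpinSq a' (M + 1) := by
  have hL : (0 : ℝ) < L := by exact_mod_cast Nat.pos_of_ne_zero (NeZero.ne L)
  -- the test state φ = S⁺a / ‖S⁺a‖
  set s : ℝ := (Real.sqrt (raiseNormSq a))⁻¹ with hs
  have hs2 : s ^ 2 * raiseNormSq a = 1 := by
    rw [hs, inv_pow, Real.sq_sqrt hN.le, inv_mul_cancel₀ hN.ne']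
  have hspos : 0 < s := by rw [hs]; exact inv_pos.mpr (Real.sqrt_pos.mpr hN)
  set φ : TensorIndex (TorusSite 2 L) 2 → ℝ := s • raiseSum a with hφ
  have hφσ : ∀ σ, φ σ = s * raiseSum a σ := fun σ => rfl
  -- unit
  have hunit : ∑ σ, φ σ ^ 2 = 1 := by
    simp only [hφσ, mul_pow]
    rw [← Finset.mul_sum]; exact hs2
  -- translation invariant
  have hφinv : ∀ v σ, φ (shiftCfg L v σ) = φ σ := by
    intro v σ; rw [hφσ, hφσ, raiseSum_shiftCfg a hinv]
  -- in the sector M + 1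
  have hφmem : cplx L φ ∈ spinZSector (Λ := TorusSite 2 L) 1 (M + 1) := by
    have h0 := mem_spinZSector_of_support (M + 1) (raiseSum a) (raiseSum_support_perron ha)
    have e : cplx L φ = (s : ℂ) • (fun τ => (raiseSum a τ : ℂ)) := by
      funext σ; simp [cplx, hφσ]
    rw [e]
    exact Submodule.smul_mem _ _ h0
  -- the gap hypothesis at φ
  have hg := hgap φ hφmem hφinv hunit
  -- ⟨a', φ⟩² = towerFidelity a a'
  have hover : (∑ σ, a' σ * φ σ) ^ 2 = towerFidelity a a' := by
    have e1 : ∑ σ, a' σ * φ σ = s * towerSum a a' := by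
      simp only [hφσ]
      rw [← sum_mul_raiseSum_eq_towerSum, Finset.mul_sum]
      exact Finset.sum_congr rfl fun σ _ => by ring
    rw [e1, mul_pow, towerSum_sq_eq]
    calc s ^ 2 * (towerFidelity a a' * raiseNormSq a) = towerFidelity a a' * (s ^ 2 * raiseNormSq a) := by ring
      _ = towerFidelity a a' := by rw [hs2, mul_one]
  -- energyQ φ = energyQ (S⁺a) / ‖S⁺a‖²
  have henergy : energyQ L Δ φ = s ^ 2 * energyQ L Δ (raiseSum a) := by rw [hφ, energyQ_smul]
  rw [hover, henergy] at hg
  -- (1 − F)·N ≤ (L/c₁)(energyQ(S⁺a) − E(M+1) N)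
  have hLc : 0 ≤ (L : ℝ) / c₁ := (div_pos hL hc₁).le
  have h2 : 1 - towerFidelity a a' ≤ (L : ℝ) / c₁ * (s ^ 2 * energyQ L Δ (raiseSum a) - sectorE L Δ (M + 1)) := by
    have h3 := mul_le_mul_of_nonneg_left hg hLc
    have e : (L : ℝ) / c₁ * (c₁ / (L : ℝ) * (1 - towerFidelity a a')) = 1 - towerFidelity a a' := by
      field_simp
    linarith
  have hkey : (1 - towerFidelity a a') * raiseNormSq a
      ≤ (L : ℝ) / c₁ * (energyQ L Δ (raiseSum a) - sectorE L Δ (M + 1) * raiseNormSq a) := by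
    have h4 := mul_le_mul_of_nonneg_right h2 hN.le
    have e2 : (L : ℝ) / c₁ * (s ^ 2 * energyQ L Δ (raiseSum a) - sectorE L Δ (M + 1)) * raiseNormSq a
        = (L : ℝ) / c₁ * (energyQ L Δ (raiseSum a) - sectorE L Δ (M + 1) * raiseNormSq a) := by
      calc (L : ℝ) / c₁ * (s ^ 2 * energyQ L Δ (raiseSum a) - sectorE L Δ (M + 1)) * raiseNormSq a
          = (L : ℝ) / c₁ * (energyQ L Δ (raiseSum a) * (s ^ 2 * raiseNormSq a)
              - sectorE L Δ (M + 1) * raiseNormSq a) := by ring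
        _ = _ := by rw [hs2, mul_one]
    linarith
  -- transfer
  have htr := spinSquaredTransfer_holds L M a a' ha.sector ha.unit ha'.unit hN
  linarith

end Summit.HubbardSuperconductivity.HubbardSuperconductivity.Theorems.AnisotropyChord.Transfer
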